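import Summits.CriticalPhenomena.SAWScalingLimit.Theorems.SAWDevelopingMapNoFoldBoundDepthTwoNumerics

/-!
# `NoFoldBound`, line Ideator3Sketch — depth-2 stratum, part II: slit coherence from a quantitative
# loop bound and middle-port dominance

Crux `NoFoldBound` (stmt-CriticalPhenomena-8296), route `SAWDevelopingMap`, lead seat c3, skeleton v7.
At an interior vertex `v` (off the source, all neighbours inside) with a neighbour `w₀ ∉ a` TOUCHING the
complement (`w₀ ∼ x ∉ Λ`, third neighbour `y`), every first arrival at `v` has a rigid winding and the three
ports carry three CONSECUTIVE classes (`depthTwo_classes`, `depthTwo_portClass`): with `(w₀, w₁, w₂)` the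
positive labelling (`w₀ → v → w₁` turns by `+π/3`) the classes are `W(w₂) = W(w₁) − 2π/3` and
`W(w₀) = W(w₁) + 2π/3` if `y → w₀ → v` turns left (then the MIDDLE port is `w₁`), `W(w₀) = W(w₁) − 4π/3` if it
turns right (middle port `w₂`) — the touching port is never the middle one. Factoring the common phase, the
slit-coherence inequality at `v` becomes the three-class inequality `three_class_bound_min'` for the real
dressed masses, whose hypotheses are supplied by

* a QUANTITATIVE slit-loop bound `Z ≤ 1/5` (hypothesis `hL`, the body of `SourceLoopBound` with the constant
  `1/5`; numerically `sup Z ≈ 0.13`), giving the dressing box of `dressed_box`;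
* MIDDLE-PORT DOMINANCE at `v` (hypothesis `hdom`): the dressed sum-mass of the middle port is at least the
  smaller of the two others (exact enumeration of this seat: ≥ 3.6× on all domains probed, |Λ| ≤ 61).

Results: `depthTwo_core` (touching neighbour in position `w₀`, `k = 19/20`), `depthTwo_coherence` (all
positions, by `adj_cases` and `norm_rotate`). Nothing unproved is asserted: the loop bound and dominance
enter as hypotheses. [folklore assembly]
-/

noncomputable section

open scoped BigOperators
open Literature.Probability.LatticeModels Literature.Probability.RandomPlanarGeometry.SAW

namespace Summit.CriticalPhenomena.SAWScalingLimit.Theorems.SAWDevelopingMapNoFoldBound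

/-! ## The depth-2 core -/

/-- **Depth-2 core (touching neighbour in position `w₀`, positive labelling).** Let `Λ` be simply
connected with source `a ∈ ∂Ω`, `v ∈ Λ` off `a` with pairwise distinct neighbours `w₀, w₁, w₂` in the
positive order (turn `w₀ → v → w₁ = +π/3`), `w₀ ∈ Λ` off `a` TOUCHING the complement: `w₀ ∼ x ∉ Λ`
(`x ≠ v`) with third neighbour `y`. Assume the quantitative slit-loop bound `hL` (returning-loop series
`≤ 1/5` in every simply connected domain) and middle-port dominance `hdom` at `v` (if `y → w₀ → v` turns
left the dressed sum-mass of `w₁` is at least the smaller of those of `w₀, w₂`; if it turns right, that of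
`w₂` is at least the smaller of those of `w₀, w₁`). Then the slit-coherence inequality holds at `v` with
`k = 19/20`. [folklore assembly] -/
theorem depthTwo_core
    (hL : ∀ (Λ : Finset HexVertex), hexDomainSimplyConnected Λ →
      ∀ u v w₁ w₂ : HexVertex, u ∉ Λ → v ∈ Λ → hexGraph.Adj v u → hexGraph.Adj v w₁ →
        hexGraph.Adj v w₂ → u ≠ w₁ → u ≠ w₂ → w₁ ≠ w₂ →
        (∑ γ : HexMidEdgeSAW (Λ.erase v) s(v, w₁) s(v, w₂), hexCriticalFugacity ^ γ.length) ≤ 1 / 5)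
    {Λ : Finset HexVertex} (hΛ : hexDomainSimplyConnected Λ) {a : Sym2 HexVertex}
    (ha : a ∈ hexDomainBoundary Λ) {v : HexVertex} (hv : v ∈ Λ) (hva : v ∉ a)
    {w₀ w₁ w₂ x y : HexVertex} (h₀ : hexGraph.Adj v w₀) (h₁ : hexGraph.Adj v w₁)
    (h₂ : hexGraph.Adj v w₂) (h₀₁ : w₀ ≠ w₁) (h₁₂ : w₁ ≠ w₂) (h₀₂ : w₀ ≠ w₂) (hw₀ : w₀ ∈ Λ)
    (hw₀a : w₀ ∉ a)
    (hchir : winding [hexMidpoint s(w₀, v), hexCenter v, hexMidpoint s(v, w₁)] = Real.pi / 3)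
    (hwx : hexGraph.Adj w₀ x) (hwy : hexGraph.Adj w₀ y) (hvx : v ≠ x) (hxy : x ≠ y) (hvy : v ≠ y)
    (hx : x ∉ Λ)
    (hdom : let xc : ℝ := hexCriticalFugacity
      let α : ℝ := 1 + 2 * hexCriticalFugacity * Real.cos (5 * Real.pi / 24)
      let s : (w p q : HexVertex) → ℝ := fun w p q =>
        ∑ γ : HexMidEdgeSAW Λ a s(v, w), if v ∉ γ.verts then xc ^ γ.length *
          (α - Real.sqrt 3 * xc *
            ∑ δ : HexMidEdgeSAW ((Λ \ γ.verts.toFinset).erase v) s(v, p) s(v, q), xc ^ δ.length) else 0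
      (winding [hexMidpoint s(y, w₀), hexCenter w₀, hexMidpoint s(w₀, v)] = Real.pi / 3 →
          min (s w₀ w₁ w₂) (s w₂ w₀ w₁) ≤ s w₁ w₂ w₀) ∧
        (winding [hexMidpoint s(y, w₀), hexCenter w₀, hexMidpoint s(w₀, v)] = -(Real.pi / 3) →
          min (s w₀ w₁ w₂) (s w₁ w₂ w₀) ≤ s w₂ w₀ w₁)) :
    let x : ℝ := hexCriticalFugacity
    let α : ℝ := 1 + 2 * hexCriticalFugacity * Real.cos (5 * Real.pi / 24)
    let β : ℝ := 1 + 2 * hexCriticalFugacity * Real.cos (11 * Real.pi / 24)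
    let ω : ℂ := Complex.exp (2 * Real.pi * Complex.I / 3)
    let Z : (w p q : HexVertex) → HexMidEdgeSAW Λ a s(v, w) → ℝ :=
      fun w p q (γ : HexMidEdgeSAW Λ a s(v, w)) =>
      ∑ δ : HexMidEdgeSAW ((Λ \ γ.verts.toFinset).erase v) s(v, p) s(v, q), x ^ δ.length
    let B : (w p q : HexVertex) → ℂ := fun w p q =>
      ∑ γ : HexMidEdgeSAW Λ a s(v, w), if v ∉ γ.verts then
        γ.weight x (5 / 8) * ((β + Real.sqrt 3 * x * Z w p q γ : ℝ) : ℂ) else 0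
    let S : (w p q : HexVertex) → ℂ := fun w p q =>
      ∑ γ : HexMidEdgeSAW Λ a s(v, w), if v ∉ γ.verts then
        γ.weight x (5 / 8) * ((α - Real.sqrt 3 * x * Z w p q γ : ℝ) : ℂ) else 0
    ‖B w₀ w₁ w₂ + ω * B w₁ w₂ w₀ + ω ^ 2 * B w₂ w₀ w₁‖ ≤
      19 / 20 * ‖S w₀ w₁ w₂ + S w₁ w₂ w₀ + S w₂ w₀ w₁‖ := by
  dsimp only at hdom ⊢
  -- the turns at `v` from the chirality
  obtain ⟨ε, hε, T01, -, T20, T10, -, -⟩ := stub_localTurns v w₀ w₁ w₂ h₀ h₁ h₂ h₀₁ h₁₂ h₀₂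
  have hε1 : ε = 1 := by
    rcases hε with h | h
    · exact h
    · exfalso
      rw [h] at T01
      have := Real.pi_pos
      linarith [T01.symm.trans hchir]
  subst hε1
  simp only [one_mul] at T20 T10
  -- the turns at `w₀` (neighbours `y, v, x`)
  obtain ⟨ε', hε', Tyv, Tvx, -, -, -, Tyx⟩ :=
    stub_localTurns w₀ y v x hwy h₀.symm hwx hvy.symm hvx hxy.symm
  set x := hexCriticalFugacity with hxc
  set α : ℝ := 1 + 2 * x * Real.cos (5 * Real.pi / 24) with hα
  set β : ℝ := 1 + 2 * x * Real.cos (11 * Real.pi / 24) with hβ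
  set ω : ℂ := Complex.exp (2 * Real.pi * Complex.I / 3) with hω
  have x0 : 0 ≤ x := nfb_xc_pos.le
  have hω1 : ‖ω‖ = 1 := norm_omega
  -- the six sums
  set S0 := ∑ γ : HexMidEdgeSAW Λ a s(v, w₀), if v ∉ γ.verts then γ.weight x (5 / 8) * ((α - Real.sqrt 3 * x *
    ∑ δ : HexMidEdgeSAW ((Λ \ γ.verts.toFinset).erase v) s(v, w₁) s(v, w₂), x ^ δ.length : ℝ) : ℂ) else 0 with hS0
  set S1 := ∑ γ : HexMidEdgeSAW Λ a s(v, w₁), if v ∉ γ.verts then γ.weight x (5 / 8) * ((α - Real.sqrt 3 * x *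
    ∑ δ : HexMidEdgeSAW ((Λ \ γ.verts.toFinset).erase v) s(v, w₂) s(v, w₀), x ^ δ.length : ℝ) : ℂ) else 0 with hS1
  set S2 := ∑ γ : HexMidEdgeSAW Λ a s(v, w₂), if v ∉ γ.verts then γ.weight x (5 / 8) * ((α - Real.sqrt 3 * x *
    ∑ δ : HexMidEdgeSAW ((Λ \ γ.verts.toFinset).erase v) s(v, w₀) s(v, w₁), x ^ δ.length : ℝ) : ℂ) else 0 with hS2
  set B0 := ∑ γ : HexMidEdgeSAW Λ a s(v, w₀), if v ∉ γ.verts then γ.weight x (5 / 8) * ((β + Real.sqrt 3 * x *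
    ∑ δ : HexMidEdgeSAW ((Λ \ γ.verts.toFinset).erase v) s(v, w₁) s(v, w₂), x ^ δ.length : ℝ) : ℂ) else 0 with hB0
  set B1 := ∑ γ : HexMidEdgeSAW Λ a s(v, w₁), if v ∉ γ.verts then γ.weight x (5 / 8) * ((β + Real.sqrt 3 * x *
    ∑ δ : HexMidEdgeSAW ((Λ \ γ.verts.toFinset).erase v) s(v, w₂) s(v, w₀), x ^ δ.length : ℝ) : ℂ) else 0 with hB1
  set B2 := ∑ γ : HexMidEdgeSAW Λ a s(v, w₂), if v ∉ γ.verts then γ.weight x (5 / 8) * ((β + Real.sqrt 3 * x *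
    ∑ δ : HexMidEdgeSAW ((Λ \ γ.verts.toFinset).erase v) s(v, w₀) s(v, w₁), x ^ δ.length : ℝ) : ℂ) else 0 with hB2
  -- the real dressed masses
  set s₀ : ℝ := ∑ γ : HexMidEdgeSAW Λ a s(v, w₀), if v ∉ γ.verts then x ^ γ.length *
    (α - Real.sqrt 3 * x * ∑ δ : HexMidEdgeSAW ((Λ \ γ.verts.toFinset).erase v) s(v, w₁) s(v, w₂), x ^ δ.length) else 0 with hs₀
  set s₁ : ℝ := ∑ γ : HexMidEdgeSAW Λ a s(v, w₁), if v ∉ γ.verts then x ^ γ.length *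
    (α - Real.sqrt 3 * x * ∑ δ : HexMidEdgeSAW ((Λ \ γ.verts.toFinset).erase v) s(v, w₂) s(v, w₀), x ^ δ.length) else 0 with hs₁
  set s₂ : ℝ := ∑ γ : HexMidEdgeSAW Λ a s(v, w₂), if v ∉ γ.verts then x ^ γ.length *
    (α - Real.sqrt 3 * x * ∑ δ : HexMidEdgeSAW ((Λ \ γ.verts.toFinset).erase v) s(v, w₀) s(v, w₁), x ^ δ.length) else 0 with hs₂
  set b₀ : ℝ := ∑ γ : HexMidEdgeSAW Λ a s(v, w₀), if v ∉ γ.verts then x ^ γ.length *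
    (β + Real.sqrt 3 * x * ∑ δ : HexMidEdgeSAW ((Λ \ γ.verts.toFinset).erase v) s(v, w₁) s(v, w₂), x ^ δ.length) else 0 with hb₀
  set b₁ : ℝ := ∑ γ : HexMidEdgeSAW Λ a s(v, w₁), if v ∉ γ.verts then x ^ γ.length *
    (β + Real.sqrt 3 * x * ∑ δ : HexMidEdgeSAW ((Λ \ γ.verts.toFinset).erase v) s(v, w₂) s(v, w₀), x ^ δ.length) else 0 with hb₁
  set b₂ : ℝ := ∑ γ : HexMidEdgeSAW Λ a s(v, w₂), if v ∉ γ.verts then x ^ γ.length *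
    (β + Real.sqrt 3 * x * ∑ δ : HexMidEdgeSAW ((Λ \ γ.verts.toFinset).erase v) s(v, w₀) s(v, w₁), x ^ δ.length) else 0 with hb₂
  -- slit loop bounds (`≤ 1/5`; slit domains are simply connected)
  have loop_bd : ∀ (e p q : HexVertex), hexGraph.Adj v e → hexGraph.Adj v p → hexGraph.Adj v q →
      e ≠ p → e ≠ q → p ≠ q → ∀ γ : HexMidEdgeSAW Λ a s(v, e), v ∉ γ.verts →
      0 ≤ ∑ δ : HexMidEdgeSAW ((Λ \ γ.verts.toFinset).erase v) s(v, p) s(v, q), x ^ δ.length ∧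
      (∑ δ : HexMidEdgeSAW ((Λ \ γ.verts.toFinset).erase v) s(v, p) s(v, q), x ^ δ.length) ≤ 1 / 5 := by
    intro e p q he hp hq hep heq hpq γ hγ
    refine ⟨Finset.sum_nonneg fun δ _ => pow_nonneg x0 _, ?_⟩
    have heγ : e ∈ γ.verts := mem_verts_of_firstArrival hva γ hγ
    have he' : e ∉ Λ \ γ.verts.toFinset := fun h =>
      (Finset.mem_sdiff.1 h).2 (List.mem_toFinset.2 heγ)
    have hv' : v ∈ Λ \ γ.verts.toFinset :=
      Finset.mem_sdiff.2 ⟨hv, fun h => hγ (List.mem_toFinset.1 h)⟩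
    exact hL _ (stub_slitSC Λ hΛ a ha _ γ) e v p q he' hv' he hp hq hep heq hpq
  -- termwise dressing box
  have term_bd : ∀ Zγ : ℝ, 0 ≤ Zγ → Zγ ≤ 1 / 5 →
      0 ≤ α - Real.sqrt 3 * x * Zγ ∧
      3 / 5 * (α - Real.sqrt 3 * x * Zγ) ≤ β + Real.sqrt 3 * x * Zγ ∧
      β + Real.sqrt 3 * x * Zγ ≤ 4 / 5 * (α - Real.sqrt 3 * x * Zγ) := by
    intro Zγ hZ0 hZc
    obtain ⟨hl, hu, h0⟩ := dressed_box hZ0 hZc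
    exact ⟨h0, hl, hu⟩
  -- bounds on the real masses
  have L0 := fun (γ : HexMidEdgeSAW Λ a s(v, w₀)) (hγ : v ∉ γ.verts) =>
    loop_bd w₀ w₁ w₂ h₀ h₁ h₂ h₀₁ h₀₂ h₁₂ γ hγ
  have L1 := fun (γ : HexMidEdgeSAW Λ a s(v, w₁)) (hγ : v ∉ γ.verts) =>
    loop_bd w₁ w₂ w₀ h₁ h₂ h₀ h₁₂ h₀₁.symm h₀₂.symm γ hγ
  have L2 := fun (γ : HexMidEdgeSAW Λ a s(v, w₂)) (hγ : v ∉ γ.verts) =>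
    loop_bd w₂ w₀ w₁ h₂ h₀ h₁ h₀₂.symm h₁₂.symm h₀₁ γ hγ
  have hs0 : 0 ≤ s₀ := sum_ite_pow_mul_nonneg _ x0 _ fun γ hγ => (term_bd _ (L0 γ hγ).1 (L0 γ hγ).2).1
  have hs1 : 0 ≤ s₁ := sum_ite_pow_mul_nonneg _ x0 _ fun γ hγ => (term_bd _ (L1 γ hγ).1 (L1 γ hγ).2).1
  have hs2 : 0 ≤ s₂ := sum_ite_pow_mul_nonneg _ x0 _ fun γ hγ => (term_bd _ (L2 γ hγ).1 (L2 γ hγ).2).1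
  have hb0l : 3 / 5 * s₀ ≤ b₀ := sum_ite_pow_mul_ge _ x0 _ _ fun γ hγ => (term_bd _ (L0 γ hγ).1 (L0 γ hγ).2).2.1
  have hb1l : 3 / 5 * s₁ ≤ b₁ := sum_ite_pow_mul_ge _ x0 _ _ fun γ hγ => (term_bd _ (L1 γ hγ).1 (L1 γ hγ).2).2.1
  have hb2l : 3 / 5 * s₂ ≤ b₂ := sum_ite_pow_mul_ge _ x0 _ _ fun γ hγ => (term_bd _ (L2 γ hγ).1 (L2 γ hγ).2).2.1
  have hb0u : b₀ ≤ 4 / 5 * s₀ := sum_ite_pow_mul_le _ x0 _ _ fun γ hγ => (term_bd _ (L0 γ hγ).1 (L0 γ hγ).2).2.2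
  have hb1u : b₁ ≤ 4 / 5 * s₁ := sum_ite_pow_mul_le _ x0 _ _ fun γ hγ => (term_bd _ (L1 γ hγ).1 (L1 γ hγ).2).2.2
  have hb2u : b₂ ≤ 4 / 5 * s₂ := sum_ite_pow_mul_le _ x0 _ _ fun γ hγ => (term_bd _ (L2 γ hγ).1 (L2 γ hγ).2).2.2
  -- the rigid classes: ports `w₁, w₂` (through the door `{w₀, x}`)
  have cls := fun (p p' : HexVertex) (hp : hexGraph.Adj v p) (hp' : hexGraph.Adj v p')
      (hpw : p ≠ w₀) (hp'w : p' ≠ w₀) (γ : HexMidEdgeSAW Λ a s(v, p))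
      (γ' : HexMidEdgeSAW Λ a s(v, p')) (hγ : v ∉ γ.verts) (hγ' : v ∉ γ'.verts) =>
    depthTwo_classes hΛ ha hv hva hw₀ hw₀a h₀.symm hwx hwy hvx hxy hvy hx hp hp' hpw hp'w γ γ' hγ hγ'
  -- the port `w₀` itself
  have cls0 := fun (p : HexVertex) (hp : hexGraph.Adj v p) (hpw : p ≠ w₀)
      (γw : HexMidEdgeSAW Λ a s(v, w₀)) (γ : HexMidEdgeSAW Λ a s(v, p))
      (hγw : v ∉ γw.verts) (hγ : v ∉ γ.verts) =>
    depthTwo_portClass hΛ ha hv hva hw₀ hw₀a h₀.symm hwx hwy hvx hxy hvy hx hp hpw γw γ hγw hγ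
  -- the offset of the class of `w₀` relative to `w₁`: `δ₀ = (3ε' - 1)π/3`
  set δ₀ : ℝ := (3 * ε' - 1) * (Real.pi / 3) with hδ₀
  have hW0_of : ∀ (γ₀ : HexMidEdgeSAW Λ a s(v, w₀)) (γ₁ : HexMidEdgeSAW Λ a s(v, w₁)),
      v ∉ γ₀.verts → v ∉ γ₁.verts → γ₀.winding = γ₁.winding + δ₀ := by
    intro γ₀ γ₁ hγ₀ hγ₁
    have h := cls0 w₁ h₁ h₀₁.symm γ₀ γ₁ hγ₀ hγ₁
    rw [winding_center_center_mid, winding_center_center_mid', Tyv, Tyx, T10, Tvx] at h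
    rw [hδ₀]; linarith
  have hW02_of : ∀ (γ₀ : HexMidEdgeSAW Λ a s(v, w₀)) (γ₂ : HexMidEdgeSAW Λ a s(v, w₂)),
      v ∉ γ₀.verts → v ∉ γ₂.verts → γ₀.winding = γ₂.winding + 2 * Real.pi / 3 + δ₀ := by
    intro γ₀ γ₂ hγ₀ hγ₂
    have h := cls0 w₂ h₂ h₀₂.symm γ₀ γ₂ hγ₀ hγ₂
    rw [winding_center_center_mid, winding_center_center_mid', Tyv, Tyx, T20, Tvx] at h
    rw [hδ₀]; linarith
  have hW : ∃ W : ℝ, (∀ γ : HexMidEdgeSAW Λ a s(v, w₁), v ∉ γ.verts → γ.winding = W) ∧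
      (∀ γ : HexMidEdgeSAW Λ a s(v, w₂), v ∉ γ.verts → γ.winding = W + -(2 * Real.pi / 3)) ∧
      (∀ γ : HexMidEdgeSAW Λ a s(v, w₀), v ∉ γ.verts → γ.winding = W + δ₀) := by
    by_cases hex₁ : ∃ γ₁ : HexMidEdgeSAW Λ a s(v, w₁), v ∉ γ₁.verts
    · obtain ⟨γ₁, hγ₁⟩ := hex₁
      refine ⟨γ₁.winding, fun γ hγ => ?_, fun γ hγ => ?_, fun γ hγ => hW0_of γ γ₁ hγ hγ₁⟩
      · have h := cls w₁ w₁ h₁ h₁ h₀₁.symm h₀₁.symm γ γ₁ hγ hγ₁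
        linarith
      · have h := cls w₁ w₂ h₁ h₂ h₀₁.symm h₀₂.symm γ₁ γ hγ₁ hγ
        rw [T10, T20] at h
        linarith
    · push Not at hex₁
      by_cases hex₂ : ∃ γ₂ : HexMidEdgeSAW Λ a s(v, w₂), v ∉ γ₂.verts
      · obtain ⟨γ₂, hγ₂⟩ := hex₂
        refine ⟨γ₂.winding + 2 * Real.pi / 3, fun γ hγ => absurd (hex₁ γ) hγ, fun γ hγ => ?_,
          fun γ hγ => ?_⟩
        · have h := cls w₂ w₂ h₂ h₂ h₀₂.symm h₀₂.symm γ γ₂ hγ hγ₂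
          linarith
        · have h := hW02_of γ γ₂ hγ hγ₂
          linarith
      · push Not at hex₂
        by_cases hex₀ : ∃ γ₀ : HexMidEdgeSAW Λ a s(v, w₀), v ∉ γ₀.verts
        · obtain ⟨γ₀, hγ₀⟩ := hex₀
          refine ⟨γ₀.winding - δ₀, fun γ hγ => absurd (hex₁ γ) hγ, fun γ hγ => absurd (hex₂ γ) hγ,
            fun γ hγ => ?_⟩
          obtain ⟨L, hL0⟩ := verts_eq_of_touching hva hw₀a h₀.symm hwx hwy hvx hxy hvy hx γ hγ
          obtain ⟨L', hL0'⟩ := verts_eq_of_touching hva hw₀a h₀.symm hwx hwy hvx hxy hvy hx γ₀ hγ₀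
          obtain ⟨γ', -, hw'⟩ := exists_retarget hw₀a hx γ hL0
          obtain ⟨γ₀', -, hw₀'⟩ := exists_retarget hw₀a hx γ₀ hL0'
          have hrig := HexMidEdgeSAW.winding_eq_of_mem_boundary hΛ ha
            (door_mem_hexDomainBoundary hx hw₀ hwx) γ' γ₀'
          rw [hw', hw₀'] at hrig
          linarith
        · push Not at hex₀
          exact ⟨0, fun γ hγ => absurd (hex₁ γ) hγ, fun γ hγ => absurd (hex₂ γ) hγ,
            fun γ hγ => absurd (hex₀ γ) hγ⟩
  obtain ⟨W, hW₁, hW₂, hW₀⟩ := hW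
  -- phase factorisations
  have E1S : S1 = Complex.exp (-Complex.I * (5 / 8 : ℝ) * W) * (s₁ : ℂ) :=
    sum_ite_weight_mul_eq _ W x (5 / 8) _ hW₁
  have E1B : B1 = Complex.exp (-Complex.I * (5 / 8 : ℝ) * W) * (b₁ : ℂ) :=
    sum_ite_weight_mul_eq _ W x (5 / 8) _ hW₁
  have E2S : S2 = Complex.exp (-Complex.I * (5 / 8 : ℝ) * ((W + -(2 * Real.pi / 3) : ℝ) : ℂ)) * (s₂ : ℂ) :=
    sum_ite_weight_mul_eq _ (W + -(2 * Real.pi / 3)) x (5 / 8) _ hW₂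
  have E2B : B2 = Complex.exp (-Complex.I * (5 / 8 : ℝ) * ((W + -(2 * Real.pi / 3) : ℝ) : ℂ)) * (b₂ : ℂ) :=
    sum_ite_weight_mul_eq _ (W + -(2 * Real.pi / 3)) x (5 / 8) _ hW₂
  have E0S : S0 = Complex.exp (-Complex.I * (5 / 8 : ℝ) * ((W + δ₀ : ℝ) : ℂ)) * (s₀ : ℂ) :=
    sum_ite_weight_mul_eq _ (W + δ₀) x (5 / 8) _ hW₀
  have E0B : B0 = Complex.exp (-Complex.I * (5 / 8 : ℝ) * ((W + δ₀ : ℝ) : ℂ)) * (b₀ : ℂ) :=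
    sum_ite_weight_mul_eq _ (W + δ₀) x (5 / 8) _ hW₀
  set e : ℂ := Complex.exp (-Complex.I * (5 / 8 : ℝ) * W) with he
  have hen : ‖e‖ = 1 := by
    rw [he, show -Complex.I * (5 / 8 : ℝ) * (W : ℂ) = ((-((5 / 8 : ℝ) * W) : ℝ) : ℂ) * Complex.I by
      push_cast; ring, Complex.norm_exp_ofReal_mul_I]
  set Q : ℂ := Complex.exp ((5 * Real.pi / 12 : ℝ) * Complex.I) with hQ
  set Qb : ℂ := Complex.exp (-((5 * Real.pi / 12 : ℝ) * Complex.I)) with hQb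
  have hQn : ‖Q‖ = 1 := by rw [hQ, Complex.norm_exp_ofReal_mul_I]
  have hQsigma : Complex.exp (Complex.I * (5 / 8 : ℝ) * ((2 * Real.pi / 3 : ℝ) : ℂ)) = Q := by
    rw [hQ]; exact exp_sigma_eq
  rw [E0S, E0B, E1S, E1B, E2S, E2B, exp_sub_phase, hQsigma]
  rcases hε' with rfl | rfl
  · /- `y → w₀ → v` turns LEFT: `δ₀ = 2π/3`, classes `(w₂, w₁, w₀)` consecutive, middle port `w₁` -/
    have hδ : δ₀ = 2 * Real.pi / 3 := by rw [hδ₀]; ring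
    have hdom₁ : min s₀ s₂ ≤ s₁ := hdom.1 (by rw [Tyv]; ring)
    have hph : Complex.exp (-Complex.I * (5 / 8 : ℝ) * ((W + δ₀ : ℝ) : ℂ)) = e * Qb := by
      rw [exp_add_phase, hδ, hQb, exp_neg_sigma_eq]
    rw [hph]
    have eL : e * Qb * (b₀ : ℂ) + ω * (e * (b₁ : ℂ)) + ω ^ 2 * (e * Q * (b₂ : ℂ)) =
        ω * e * ((b₁ : ℂ) + b₂ * (ω * Q) + b₀ * (ω ^ 2 * Qb)) := by
      have hω3 : ω ^ 3 = 1 := omega_pow_three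
      linear_combination (-(e * Qb * (b₀ : ℂ))) * hω3
    have eR : e * Qb * (s₀ : ℂ) + e * (s₁ : ℂ) + e * Q * (s₂ : ℂ) = e * ((s₁ : ℂ) + s₂ * Q + s₀ * Qb) := by ring
    rw [eL, eR]
    simp only [norm_mul, hω1, hen, one_mul]
    rw [hω, hQ, hQb, omega_mul_expQ, omega_sq_mul_exp_neg]
    exact three_class_bound_min' hs1 hs2 hs0 (by rwa [min_comm] at hdom₁) hb1l hb1u hb2l hb2u hb0l hb0u
  · /- `y → w₀ → v` turns RIGHT: `δ₀ = -4π/3`, classes `(w₀, w₂, w₁)` consecutive, middle port `w₂` -/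
    have hδ : δ₀ = -(4 * Real.pi / 3) := by rw [hδ₀]; ring
    have hdom₂ : min s₀ s₁ ≤ s₂ := hdom.2 (by rw [Tyv]; ring)
    have hph : Complex.exp (-Complex.I * (5 / 8 : ℝ) * ((W + δ₀ : ℝ) : ℂ)) = e * Q ^ 2 := by
      rw [exp_add_phase, hδ, hQ, exp_neg_sigma_neg_four_pi_div_three]
    rw [hph]
    have eL : e * Q ^ 2 * (b₀ : ℂ) + ω * (e * (b₁ : ℂ)) + ω ^ 2 * (e * Q * (b₂ : ℂ)) =
        ω ^ 2 * Q * e * ((b₂ : ℂ) + b₀ * (ω * Q) + b₁ * (ω ^ 2 * Qb)) := by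
      have hω3 : ω ^ 3 = 1 := omega_pow_three
      have hQQ : Q * Qb = 1 := by
        rw [hQ, hQb, ← Complex.exp_add, add_neg_cancel, Complex.exp_zero]
      linear_combination (-(e * Q ^ 2 * (b₀ : ℂ)) - e * (b₁ : ℂ) * ω * Q * Qb) * hω3 +
        (-(e * (b₁ : ℂ) * ω)) * hQQ
    have eR : e * Q ^ 2 * (s₀ : ℂ) + e * (s₁ : ℂ) + e * Q * (s₂ : ℂ) =
        Q * e * ((s₂ : ℂ) + s₀ * Q + s₁ * Qb) := by
      have hQQ : Q * Qb = 1 := by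
        rw [hQ, hQb, ← Complex.exp_add, add_neg_cancel, Complex.exp_zero]
      linear_combination (-(e * (s₁ : ℂ))) * hQQ
    rw [eL, eR]
    simp only [norm_mul, norm_pow, hω1, hQn, hen, one_pow, one_mul]
    rw [hω, hQ, hQb, omega_mul_expQ, omega_sq_mul_exp_neg]
    exact three_class_bound_min' hs2 hs0 hs1 hdom₂ hb2l hb2u hb0l hb0u hb1l hb1u

/-! ## All positions of the touching neighbour -/

/-- **Slit coherence on the depth-2 stratum (touching neighbour off the source), every positive
labelling.** Under the quantitative slit-loop bound `hL` (`≤ 1/5`) and middle-port dominance `hdom`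
(stated for the touching neighbour in first position of a positive labelling, as in `depthTwo_core`),
the slit-coherence inequality holds with `k = 19/20` at every interior vertex `v` off the source that
has a neighbour `w ∉ a` adjacent to a vertex outside `Λ`, for every positive labelling `(w₀, w₁, w₂)`:
the touching neighbour is one of `w₀, w₁, w₂` (`adj_cases`) and the three positions are `depthTwo_core`
for the three cyclic rotations of the labelling, whose Beltrami norms agree (`norm_rotate`).
[folklore assembly] -/
theorem depthTwo_coherence
    (hL : ∀ (Λ : Finset HexVertex), hexDomainSimplyConnected Λ →
      ∀ u v w₁ w₂ : HexVertex, u ∉ Λ → v ∈ Λ → hexGraph.Adj v u → hexGraph.Adj v w₁ →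
        hexGraph.Adj v w₂ → u ≠ w₁ → u ≠ w₂ → w₁ ≠ w₂ →
        (∑ γ : HexMidEdgeSAW (Λ.erase v) s(v, w₁) s(v, w₂), hexCriticalFugacity ^ γ.length) ≤ 1 / 5)
    (hdom : ∀ (Λ : Finset HexVertex), hexDomainSimplyConnected Λ → ∀ a ∈ hexDomainBoundary Λ,
      ∀ v ∈ Λ, v ∉ a → ∀ w₀ w₁ w₂ x y : HexVertex, hexGraph.Adj v w₀ → hexGraph.Adj v w₁ →
      hexGraph.Adj v w₂ → w₀ ≠ w₁ → w₁ ≠ w₂ → w₀ ≠ w₂ → w₀ ∈ Λ → w₀ ∉ a →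
      winding [hexMidpoint s(w₀, v), hexCenter v, hexMidpoint s(v, w₁)] = Real.pi / 3 →
      hexGraph.Adj w₀ x → hexGraph.Adj w₀ y → v ≠ x → x ≠ y → v ≠ y → x ∉ Λ →
      let xc : ℝ := hexCriticalFugacity
      let α : ℝ := 1 + 2 * hexCriticalFugacity * Real.cos (5 * Real.pi / 24)
      let s : (w p q : HexVertex) → ℝ := fun w p q =>
        ∑ γ : HexMidEdgeSAW Λ a s(v, w), if v ∉ γ.verts then xc ^ γ.length *
          (α - Real.sqrt 3 * xc *
            ∑ δ : HexMidEdgeSAW ((Λ \ γ.verts.toFinset).erase v) s(v, p) s(v, q), xc ^ δ.length) else 0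
      (winding [hexMidpoint s(y, w₀), hexCenter w₀, hexMidpoint s(w₀, v)] = Real.pi / 3 →
          min (s w₀ w₁ w₂) (s w₂ w₀ w₁) ≤ s w₁ w₂ w₀) ∧
        (winding [hexMidpoint s(y, w₀), hexCenter w₀, hexMidpoint s(w₀, v)] = -(Real.pi / 3) →
          min (s w₀ w₁ w₂) (s w₁ w₂ w₀) ≤ s w₂ w₀ w₁))
    {Λ : Finset HexVertex} (hΛ : hexDomainSimplyConnected Λ) {a : Sym2 HexVertex}
    (ha : a ∈ hexDomainBoundary Λ) {v : HexVertex} (hv : v ∈ Λ) (hva : v ∉ a)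
    (hint : ∀ u : HexVertex, hexGraph.Adj v u → u ∈ Λ)
    (htouch : ∃ w x : HexVertex, hexGraph.Adj v w ∧ hexGraph.Adj w x ∧ x ≠ v ∧ x ∉ Λ ∧ w ∉ a)
    {w₀ w₁ w₂ : HexVertex} (h₀ : hexGraph.Adj v w₀) (h₁ : hexGraph.Adj v w₁) (h₂ : hexGraph.Adj v w₂)
    (h₀₁ : w₀ ≠ w₁) (h₁₂ : w₁ ≠ w₂) (h₀₂ : w₀ ≠ w₂)
    (hchir : winding [hexMidpoint s(w₀, v), hexCenter v, hexMidpoint s(v, w₁)] = Real.pi / 3) :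
    let x : ℝ := hexCriticalFugacity
    let α : ℝ := 1 + 2 * hexCriticalFugacity * Real.cos (5 * Real.pi / 24)
    let β : ℝ := 1 + 2 * hexCriticalFugacity * Real.cos (11 * Real.pi / 24)
    let ω : ℂ := Complex.exp (2 * Real.pi * Complex.I / 3)
    let Z : (w p q : HexVertex) → HexMidEdgeSAW Λ a s(v, w) → ℝ :=
      fun w p q (γ : HexMidEdgeSAW Λ a s(v, w)) =>
      ∑ δ : HexMidEdgeSAW ((Λ \ γ.verts.toFinset).erase v) s(v, p) s(v, q), x ^ δ.length
    let B : (w p q : HexVertex) → ℂ := fun w p q =>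
      ∑ γ : HexMidEdgeSAW Λ a s(v, w), if v ∉ γ.verts then
        γ.weight x (5 / 8) * ((β + Real.sqrt 3 * x * Z w p q γ : ℝ) : ℂ) else 0
    let S : (w p q : HexVertex) → ℂ := fun w p q =>
      ∑ γ : HexMidEdgeSAW Λ a s(v, w), if v ∉ γ.verts then
        γ.weight x (5 / 8) * ((α - Real.sqrt 3 * x * Z w p q γ : ℝ) : ℂ) else 0
    ‖B w₀ w₁ w₂ + ω * B w₁ w₂ w₀ + ω ^ 2 * B w₂ w₀ w₁‖ ≤
      19 / 20 * ‖S w₀ w₁ w₂ + S w₁ w₂ w₀ + S w₂ w₀ w₁‖ := by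
  dsimp only
  obtain ⟨w, x, hvw, hwx, hxv, hx, hwa⟩ := htouch
  have hwΛ : w ∈ Λ := hint w hvw
  -- the third neighbour of `w`
  obtain ⟨y, hwy, hyv, hyx⟩ : ∃ y : HexVertex, hexGraph.Adj w y ∧ y ≠ v ∧ y ≠ x := by
    have h3 := card_neighborSet_hexGraph_holds w
    obtain ⟨p, q, r, hpq, hpr, hqr, hS⟩ := Set.ncard_eq_three.1 h3
    have hp : hexGraph.Adj w p := by rw [← SimpleGraph.mem_neighborSet, hS]; simp
    have hq : hexGraph.Adj w q := by rw [← SimpleGraph.mem_neighborSet, hS]; simp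
    have hr : hexGraph.Adj w r := by rw [← SimpleGraph.mem_neighborSet, hS]; simp
    by_cases hpv : p = v
    · by_cases hqx : q = x
      · exact ⟨r, hr, fun h => hpr (hpv.trans h.symm), fun h => hqr (hqx.trans h.symm)⟩
      · exact ⟨q, hq, fun h => hpq (hpv.trans h.symm), hqx⟩
    · by_cases hpx : p = x
      · by_cases hqv : q = v
        · exact ⟨r, hr, fun h => hqr (hqv.trans h.symm), fun h => hpr (hpx.trans h.symm)⟩
        · exact ⟨q, hq, hqv, fun h => hpq (hpx.trans h.symm)⟩
      · exact ⟨p, hp, hpv, hpx⟩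
  -- the other two positive chiralities
  obtain ⟨ε, hε, T01, T12, T20, -, -, -⟩ := stub_localTurns v w₀ w₁ w₂ h₀ h₁ h₂ h₀₁ h₁₂ h₀₂
  have hε1 : ε = 1 := by
    rcases hε with h | h
    · exact h
    · exfalso
      rw [h] at T01
      have := Real.pi_pos
      linarith [T01.symm.trans hchir]
  subst hε1
  simp only [one_mul] at T12 T20
  rcases adj_cases h₀ h₁ h₂ h₀₁ h₁₂ h₀₂ hvw with rfl | rfl | rfl
  · have hd := hdom Λ hΛ a ha v hv hva w w₁ w₂ x y h₀ h₁ h₂ h₀₁ h₁₂ h₀₂ hwΛ hwa hchir hwx hwy hxv.symm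
      hyx.symm hyv.symm hx
    have h := depthTwo_core hL hΛ ha hv hva h₀ h₁ h₂ h₀₁ h₁₂ h₀₂ hwΛ hwa hchir hwx hwy hxv.symm
      hyx.symm hyv.symm hx hd
    dsimp only at h
    exact h
  · have hd := hdom Λ hΛ a ha v hv hva w w₂ w₀ x y h₁ h₂ h₀ h₁₂ h₀₂.symm h₀₁.symm hwΛ hwa T12 hwx hwy
      hxv.symm hyx.symm hyv.symm hx
    have h := depthTwo_core hL hΛ ha hv hva h₁ h₂ h₀ h₁₂ h₀₂.symm h₀₁.symm hwΛ hwa T12 hwx hwy hxv.symm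
      hyx.symm hyv.symm hx hd
    dsimp only at h
    rw [norm_rotate]
    convert h using 3
    ring
  · have hd := hdom Λ hΛ a ha v hv hva w w₀ w₁ x y h₂ h₀ h₁ h₀₂.symm h₀₁ h₁₂.symm hwΛ hwa T20 hwx hwy
      hxv.symm hyx.symm hyv.symm hx
    have h := depthTwo_core hL hΛ ha hv hva h₂ h₀ h₁ h₀₂.symm h₀₁ h₁₂.symm hwΛ hwa T20 hwx hwy hxv.symm
      hyx.symm hyv.symm hx hd
    dsimp only at h
    rw [norm_rotate, norm_rotate]
    convert h using 3
    ring

end Summit.CriticalPhenomena.SAWScalingLimit.Theorems.SAWDevelopingMapNoFoldBound
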